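import Literature.MathematicalPhysics.QuantumLattice.LocalPairOn
import Literature.MathematicalPhysics.QuantumLattice.PairFieldYangCeiling
import Summits.Ventures.CertifiedManyBodySolver.Observables.SingletPairAlgebra

/-!
# The sharp kinematic ceiling of a local singlet pair: `P_x† P_x ≤ Σ_e g(e)²`

HONEST FRAMING: first certified bounds; not a superconductivity verdict; every number certified or
labelled float.  Speedrun `mbsolver`, seat sr-mbsolver-m3-2 (pairing layer), gen 11.  A certificate-free
OPERATOR INEQUALITY (every state of every Hamiltonian): it bounds each term of the summit's pair
two-point function and says nothing about long-distance behaviour.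

For a site `x` of a finite lattice `Λ` and a bond mode `ψ_σ = Σ_{e ∈ S} c_e a_{(v e)σ}` supported away
from `x` (`v` injective on `S`, `v e ≠ x`), the singlet pair `P = a_{x↑} ψ_↓ - a_{x↓} ψ_↑` obeys
`P† P ≤ 2 Σ_e |c_e|²` (`posSemidef_smul_one_sub_sitePair`): after normalising `ψ_σ` the four modes
satisfy the CAR and the sum-of-squares identity `2 - B† B = T† T + 2 R† R` of `SingletPairAlgebra`
applies.  (The constant is attained on the two-fermion bond singlet; not proved here.)  On the torus:
`posSemidef_smul_one_sub_localPairOn` (`(localPairOn S g L x)† (…) ≤ Σ_{e ∈ S} g(e)²` for `0 ∉ S`,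
`Torus.proj L` injective on `{0} ∪ S`), **`posSemidef_four_smul_one_sub_localPair_dWave`**
(`P_x† P_x ≤ 4` for `P_x = localPair dWaveFormFactor L x`, `L ≥ 3`; the Cauchy–Schwarz constant of
`abs_re_expect_localPair_le` is `C_d² = 32`), `norm_toLp_localPair_dWave_mulVec_le` (`‖P_x ψ‖ ≤ 2‖ψ‖`),
`abs_re_expect_localPair_dWave_le_four` (`|Re ⟨ψ, P_x† P_y ψ⟩| ≤ 4` for normalised `ψ`).

References: D. J. Scalapino, Phys. Rep. 250 (1995) 329, §2 eq. (2.2)–(2.4); C. N. Yang, Rev. Mod.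
Phys. 34 (1962) 694, §4 (global companion: `PairFieldYangCeiling`); Bratteli–Robinson II §5.2.2 (CAR).
Folklore otherwise; no definition and no named fact is introduced.
-/

namespace Summit.Ventures.CertifiedManyBodySolver.Observables

open Matrix Literature.MathematicalPhysics.QuantumLattice Literature.Probability.LatticeModels
open scoped ComplexOrder ComplexConjugate

namespace SingletPair

/-! ### CAR for smeared annihilation operators -/

section Smeared

variable {ι : Type*} [LinearOrder ι] [Fintype ι]

/-- Over `ℂ`, `X X + X X = 0` forces `X X = 0`. [folklore] -/
theorem mul_self_eq_zero_of_anticomm {n : Type*} [Fintype n] {X : Matrix n n ℂ}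
    (h : X * X + X * X = 0) : X * X = 0 := by
  have h2 : (2 : ℂ) • (X * X) = 0 := by rwa [two_smul]
  exact (smul_eq_zero.1 h2).resolve_left two_ne_zero

/-- Pure CAR, one smeared operator: `a_o ψ + ψ a_o = 0`. Bratteli–Robinson II §5.2.2. [folklore] -/
theorem annihilation_anticomm_sum {κ : Type*} (s : Finset κ) (c : κ → ℂ) (p : κ → ι) (o : ι) :
    annihilation o * (∑ k ∈ s, c k • annihilation (p k)) +
        (∑ k ∈ s, c k • annihilation (p k)) * annihilation o = 0 := by
  rw [Finset.mul_sum, Finset.sum_mul, ← Finset.sum_add_distrib]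
  refine Finset.sum_eq_zero fun k _ => ?_
  rw [Matrix.mul_smul, Matrix.smul_mul, ← smul_add, annihilation_anticommute_holds, smul_zero]

/-- Pure CAR, two smeared operators: `ψ ψ' + ψ' ψ = 0`. Bratteli–Robinson II §5.2.2. [folklore] -/
theorem sum_anticomm_sum {κ κ' : Type*} (s : Finset κ) (c : κ → ℂ) (p : κ → ι)
    (s' : Finset κ') (c' : κ' → ℂ) (p' : κ' → ι) :
    (∑ k ∈ s, c k • annihilation (p k)) * (∑ k ∈ s', c' k • annihilation (p' k)) +
        (∑ k ∈ s', c' k • annihilation (p' k)) * (∑ k ∈ s, c k • annihilation (p k)) = 0 := by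
  calc (∑ k ∈ s, c k • annihilation (p k)) * (∑ k ∈ s', c' k • annihilation (p' k)) +
        (∑ k ∈ s', c' k • annihilation (p' k)) * (∑ k ∈ s, c k • annihilation (p k))
      = ∑ k ∈ s, ((c k • annihilation (p k)) * (∑ k ∈ s', c' k • annihilation (p' k)) +
          (∑ k ∈ s', c' k • annihilation (p' k)) * (c k • annihilation (p k))) := by
        rw [Finset.sum_add_distrib, ← Finset.sum_mul, ← Finset.mul_sum]
    _ = 0 := Finset.sum_eq_zero fun k _ => by
        rw [Matrix.smul_mul, Matrix.mul_smul, ← smul_add, annihilation_anticomm_sum, smul_zero]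

omit [Fintype ι] in
/-- The adjoint of a smeared annihilation operator. [folklore] -/
theorem conjTranspose_sum_smul_annihilation {κ : Type*} (s : Finset κ) (c : κ → ℂ) (p : κ → ι) :
    (∑ k ∈ s, c k • annihilation (p k))ᴴ = ∑ k ∈ s, star (c k) • creation (p k) := by
  rw [Matrix.conjTranspose_sum]
  exact Finset.sum_congr rfl fun k _ => by rw [Matrix.conjTranspose_smul, annihilation_conjTranspose]

/-- Mixed CAR off the support: `a_o ψ† + ψ† a_o = 0`. Bratteli–Robinson II §5.2.2. [folklore] -/
theorem annihilation_mixed_sum {κ : Type*} (s : Finset κ) (c : κ → ℂ) (p : κ → ι) (o : ι)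
    (h : ∀ k ∈ s, p k ≠ o) :
    annihilation o * (∑ k ∈ s, c k • annihilation (p k))ᴴ +
        (∑ k ∈ s, c k • annihilation (p k))ᴴ * annihilation o = 0 := by
  rw [conjTranspose_sum_smul_annihilation, Finset.mul_sum, Finset.sum_mul, ← Finset.sum_add_distrib]
  refine Finset.sum_eq_zero fun k hk => ?_
  rw [Matrix.mul_smul, Matrix.smul_mul, ← smul_add,
    annihilation_mul_creation_add_creation_mul_annihilation_holds, if_neg (h k hk).symm, smul_zero]

/-- Mixed CAR off the support: `ψ a_o† + a_o† ψ = 0`. Bratteli–Robinson II §5.2.2. [folklore] -/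
theorem sum_mixed_annihilation {κ : Type*} (s : Finset κ) (c : κ → ℂ) (p : κ → ι) (o : ι)
    (h : ∀ k ∈ s, p k ≠ o) :
    (∑ k ∈ s, c k • annihilation (p k)) * (annihilation o)ᴴ +
        (annihilation o)ᴴ * (∑ k ∈ s, c k • annihilation (p k)) = 0 := by
  have h1 := congrArg conjTranspose (annihilation_mixed_sum s c p o h)
  rwa [conjTranspose_add, conjTranspose_mul, conjTranspose_mul, conjTranspose_conjTranspose,
    conjTranspose_zero] at h1

/-- Mixed CAR for two smeared operators:
`ψ ψ'† + ψ'† ψ = Σ_k Σ_k' [p k = p' k'] c_k conj(c'_k') · 1`. Bratteli–Robinson II §5.2.2. [folklore] -/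
theorem sum_mixed_sum {κ κ' : Type*} (s : Finset κ) (c : κ → ℂ) (p : κ → ι)
    (s' : Finset κ') (c' : κ' → ℂ) (p' : κ' → ι) :
    (∑ k ∈ s, c k • annihilation (p k)) * (∑ k ∈ s', c' k • annihilation (p' k))ᴴ +
        (∑ k ∈ s', c' k • annihilation (p' k))ᴴ * (∑ k ∈ s, c k • annihilation (p k)) =
      ∑ k ∈ s, ∑ k' ∈ s',
        if p k = p' k' then (c k * star (c' k')) • (1 : Matrix (Finset ι) (Finset ι) ℂ) else 0 := by
  rw [conjTranspose_sum_smul_annihilation]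
  have h1 : (∑ k ∈ s, c k • annihilation (p k)) * (∑ k ∈ s', star (c' k) • creation (p' k)) =
      ∑ k ∈ s, ∑ k' ∈ s', (c k * star (c' k')) • (annihilation (p k) * creation (p' k')) := by
    rw [Finset.sum_mul_sum]
    refine Finset.sum_congr rfl fun k _ => Finset.sum_congr rfl fun k' _ => ?_
    rw [Matrix.smul_mul, Matrix.mul_smul, smul_smul]
  have h2 : (∑ k ∈ s', star (c' k) • creation (p' k)) * (∑ k ∈ s, c k • annihilation (p k)) =
      ∑ k ∈ s, ∑ k' ∈ s', (c k * star (c' k')) • (creation (p' k') * annihilation (p k)) := by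
    rw [Finset.sum_mul_sum, Finset.sum_comm]
    refine Finset.sum_congr rfl fun k _ => Finset.sum_congr rfl fun k' _ => ?_
    rw [Matrix.smul_mul, Matrix.mul_smul, smul_smul, mul_comm]
  rw [h1, h2, ← Finset.sum_add_distrib]
  refine Finset.sum_congr rfl fun k _ => ?_
  rw [← Finset.sum_add_distrib]
  refine Finset.sum_congr rfl fun k' _ => ?_
  rw [← smul_add, annihilation_mul_creation_add_creation_mul_annihilation_holds, smul_ite, smul_zero]

/-- Two smeared operators with disjoint supports: `ψ ψ'† + ψ'† ψ = 0`. [folklore] -/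
theorem sum_mixed_sum_eq_zero {κ κ' : Type*} (s : Finset κ) (c : κ → ℂ) (p : κ → ι)
    (s' : Finset κ') (c' : κ' → ℂ) (p' : κ' → ι) (h : ∀ k ∈ s, ∀ k' ∈ s', p k ≠ p' k') :
    (∑ k ∈ s, c k • annihilation (p k)) * (∑ k ∈ s', c' k • annihilation (p' k))ᴴ +
        (∑ k ∈ s', c' k • annihilation (p' k))ᴴ * (∑ k ∈ s, c k • annihilation (p k)) = 0 := by
  rw [sum_mixed_sum]
  exact Finset.sum_eq_zero fun k hk => Finset.sum_eq_zero fun k' hk' => if_neg (h k hk k' hk')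

/-- One smeared operator with injective support map: `ψ ψ† + ψ† ψ = (Σ_k |c_k|²) · 1`.
Bratteli–Robinson II §5.2.2 (`{a(f), a†(f)} = ‖f‖²`). [folklore] -/
theorem sum_mixed_self {κ : Type*} (s : Finset κ) (c : κ → ℂ) (p : κ → ι)
    (hp : Set.InjOn p s) :
    (∑ k ∈ s, c k • annihilation (p k)) * (∑ k ∈ s, c k • annihilation (p k))ᴴ +
        (∑ k ∈ s, c k • annihilation (p k))ᴴ * (∑ k ∈ s, c k • annihilation (p k)) =
      ((∑ k ∈ s, ‖c k‖ ^ 2 : ℝ) : ℂ) • (1 : Matrix (Finset ι) (Finset ι) ℂ) := by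
  rw [sum_mixed_sum]
  have hdiag : ∀ k ∈ s, (∑ k' ∈ s, if p k = p k' then (c k * star (c k')) •
      (1 : Matrix (Finset ι) (Finset ι) ℂ) else 0) = ((‖c k‖ ^ 2 : ℝ) : ℂ) • 1 := by
    intro k hk
    rw [Finset.sum_eq_single_of_mem k hk fun k' hk' hne => if_neg fun h => hne (hp hk' hk h.symm),
      if_pos rfl, Complex.star_def, Complex.mul_conj, Complex.normSq_eq_norm_sq, Complex.ofReal_pow]
  rw [Finset.sum_congr rfl hdiag, ← Finset.sum_smul, Complex.ofReal_sum]

end Smeared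

/-! ### The singlet pair between a site and a bond mode -/

section SitePair

variable {Λ : Type*} [LinearOrder Λ] [Fintype Λ]

/-- **The singlet-pair ceiling.**  For a site `x`, sites `v e` (`e ∈ S`, `v` injective on `S`,
`v e ≠ x`) and weights `c e`, the singlet pair `P = a_{x↑} ψ_↓ - a_{x↓} ψ_↑`,
`ψ_σ = Σ_{e ∈ S} c_e a_{(v e)σ}`, satisfies `P† P ≤ 2 Σ_e |c_e|²` (the difference is positive
semidefinite). Scalapino, Phys. Rep. 250 (1995) 329, §2; Bratteli–Robinson II §5.2.2. [folklore] -/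
theorem posSemidef_smul_one_sub_sitePair {E : Type*} (S : Finset E) (c : E → ℂ) (v : E → Λ) (x : Λ)
    (hv : Set.InjOn v S) (hx : ∀ e ∈ S, v e ≠ x) :
    ((((2 : ℝ) * ∑ e ∈ S, ‖c e‖ ^ 2 : ℝ) : ℂ) • (1 : Matrix (Finset (Orb Λ)) (Finset (Orb Λ)) ℂ) -
      (annihilation (orb x 0) * (∑ e ∈ S, c e • annihilation (orb (v e) 1)) -
          annihilation (orb x 1) * (∑ e ∈ S, c e • annihilation (orb (v e) 0)))ᴴ *
        (annihilation (orb x 0) * (∑ e ∈ S, c e • annihilation (orb (v e) 1)) -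
          annihilation (orb x 1) * (∑ e ∈ S, c e • annihilation (orb (v e) 0)))).PosSemidef := by
  have hν0 : 0 ≤ ∑ e ∈ S, ‖c e‖ ^ 2 := Finset.sum_nonneg fun _ _ => by positivity
  set ν : ℝ := ∑ e ∈ S, ‖c e‖ ^ 2
  set a0 : Matrix (Finset (Orb Λ)) (Finset (Orb Λ)) ℂ := annihilation (orb x 0)
  set a1 : Matrix (Finset (Orb Λ)) (Finset (Orb Λ)) ℂ := annihilation (orb x 1)
  set ψ0 : Matrix (Finset (Orb Λ)) (Finset (Orb Λ)) ℂ := ∑ e ∈ S, c e • annihilation (orb (v e) 0)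
  set ψ1 : Matrix (Finset (Orb Λ)) (Finset (Orb Λ)) ℂ := ∑ e ∈ S, c e • annihilation (orb (v e) 1)
  have hinj : ∀ σ : Fin 2, Set.InjOn (fun e => orb (v e) σ) S := fun σ e he e' he' h =>
    hv he he' (orb_eq_orb_iff.1 h).1
  have hoff : ∀ σ τ : Fin 2, ∀ e ∈ S, orb (v e) σ ≠ orb x τ := fun σ τ e he h =>
    hx e he (orb_eq_orb_iff.1 h).1
  have hdisj : ∀ e ∈ S, ∀ e' ∈ S, orb (v e) 0 ≠ orb (v e') 1 := fun e _ e' _ h =>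
    absurd (orb_eq_orb_iff.1 h).2 (by decide)
  -- the degenerate case `c = 0` on `S`
  by_cases hzero : ν = 0
  · have hc : ∀ e ∈ S, c e = 0 := fun e he => norm_eq_zero.1 (pow_eq_zero_iff two_ne_zero |>.1
      ((Finset.sum_eq_zero_iff_of_nonneg fun e _ => by positivity).1 hzero e he))
    have hψ0z : ψ0 = 0 := Finset.sum_eq_zero fun e he => by rw [hc e he, zero_smul]
    have hψ1z : ψ1 = 0 := Finset.sum_eq_zero fun e he => by rw [hc e he, zero_smul]
    rw [hψ0z, hψ1z, Matrix.mul_zero, Matrix.mul_zero, sub_zero, Matrix.mul_zero, sub_zero, hzero,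
      mul_zero, Complex.ofReal_zero, zero_smul]
    exact Matrix.PosSemidef.zero
  have hsqrt : Real.sqrt ν ≠ 0 := Real.sqrt_ne_zero'.2 (lt_of_le_of_ne hν0 (Ne.symm hzero))
  -- normalised bond modes
  set r : ℝ := (Real.sqrt ν)⁻¹ with hr
  set b0 : Matrix (Finset (Orb Λ)) (Finset (Orb Λ)) ℂ := (r : ℂ) • ψ0 with hb0
  set b1 : Matrix (Finset (Orb Λ)) (Finset (Orb Λ)) ℂ := (r : ℂ) • ψ1 with hb1
  have hrr : ((r : ℂ) * star (r : ℂ)) * (ν : ℂ) = 1 := by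
    rw [Complex.star_def, Complex.conj_ofReal, ← Complex.ofReal_mul, ← Complex.ofReal_mul, hr,
      ← mul_inv, Real.mul_self_sqrt hν0, inv_mul_cancel₀ hzero, Complex.ofReal_one]
  have santi : ∀ {X Y : Matrix (Finset (Orb Λ)) (Finset (Orb Λ)) ℂ} (a b : ℂ),
      X * Y + Y * X = 0 → (a • X) * (b • Y) + (b • Y) * (a • X) = 0 := by
    intro X Y a b h
    rw [Matrix.smul_mul, Matrix.mul_smul, smul_smul, Matrix.smul_mul, Matrix.mul_smul, smul_smul,
      mul_comm b a, ← smul_add, h, smul_zero]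
  have santi₁ : ∀ {X Y : Matrix (Finset (Orb Λ)) (Finset (Orb Λ)) ℂ} (b : ℂ),
      X * Y + Y * X = 0 → X * (b • Y) + (b • Y) * X = 0 := by
    intro X Y b h
    rw [Matrix.mul_smul, Matrix.smul_mul, ← smul_add, h, smul_zero]
  have smix : ∀ {X Y Z : Matrix (Finset (Orb Λ)) (Finset (Orb Λ)) ℂ} (a b : ℂ),
      X * Yᴴ + Yᴴ * X = Z → (a • X) * (b • Y)ᴴ + (b • Y)ᴴ * (a • X) = (a * star b) • Z := by
    intro X Y Z a b h
    rw [Matrix.conjTranspose_smul, Matrix.smul_mul, Matrix.mul_smul, smul_smul, Matrix.smul_mul,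
      Matrix.mul_smul, smul_smul, mul_comm (star b) a, ← smul_add, h]
  have smix₁ : ∀ {X Y : Matrix (Finset (Orb Λ)) (Finset (Orb Λ)) ℂ} (b : ℂ),
      X * Yᴴ + Yᴴ * X = 0 → X * (b • Y)ᴴ + (b • Y)ᴴ * X = 0 := by
    intro X Y b h
    rw [Matrix.conjTranspose_smul, Matrix.mul_smul, Matrix.smul_mul, ← smul_add, h, smul_zero]
  -- the twenty CAR relations of the four modes `a0, a1, b0, b1`
  have p01 : a0 * a1 + a1 * a0 = 0 := annihilation_anticommute_holds _ _
  have p02 : a0 * b0 + b0 * a0 = 0 := santi₁ _ (annihilation_anticomm_sum S c _ _)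
  have p03 : a0 * b1 + b1 * a0 = 0 := santi₁ _ (annihilation_anticomm_sum S c _ _)
  have p12 : a1 * b0 + b0 * a1 = 0 := santi₁ _ (annihilation_anticomm_sum S c _ _)
  have p13 : a1 * b1 + b1 * a1 = 0 := santi₁ _ (annihilation_anticomm_sum S c _ _)
  have p23 : b0 * b1 + b1 * b0 = 0 := santi _ _ (sum_anticomm_sum S c _ S c _)
  have z0 : a0 * a0 = 0 := mul_self_eq_zero_of_anticomm (annihilation_anticommute_holds _ _)
  have z1 : a1 * a1 = 0 := mul_self_eq_zero_of_anticomm (annihilation_anticommute_holds _ _)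
  have z2 : b0 * b0 = 0 := mul_self_eq_zero_of_anticomm (santi _ _ (sum_anticomm_sum S c _ S c _))
  have z3 : b1 * b1 = 0 := mul_self_eq_zero_of_anticomm (santi _ _ (sum_anticomm_sum S c _ S c _))
  have d0 : a0 * star a0 + star a0 * a0 = 1 := by
    have h := annihilation_mul_creation_add_creation_mul_annihilation_holds (orb x (0 : Fin 2)) (orb x 0)
    rwa [if_pos rfl] at h
  have d1 : a1 * star a1 + star a1 * a1 = 1 := by
    have h := annihilation_mul_creation_add_creation_mul_annihilation_holds (orb x (1 : Fin 2)) (orb x 1)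
    rwa [if_pos rfl] at h
  have d2 : b0 * star b0 + star b0 * b0 = 1 := by
    rw [← one_smul ℂ (1 : Matrix (Finset (Orb Λ)) (Finset (Orb Λ)) ℂ), ← hrr, ← smul_smul]
    exact smix (r : ℂ) (r : ℂ) (sum_mixed_self S c (fun e => orb (v e) 0) (hinj 0))
  have d3 : b1 * star b1 + star b1 * b1 = 1 := by
    rw [← one_smul ℂ (1 : Matrix (Finset (Orb Λ)) (Finset (Orb Λ)) ℂ), ← hrr, ← smul_smul]
    exact smix (r : ℂ) (r : ℂ) (sum_mixed_self S c (fun e => orb (v e) 1) (hinj 1))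
  have m01 : a0 * star a1 + star a1 * a0 = 0 := by
    have h := annihilation_mul_creation_add_creation_mul_annihilation_holds (orb x (0 : Fin 2)) (orb x 1)
    rwa [if_neg (by simp)] at h
  have m02 : a0 * star b0 + star b0 * a0 = 0 :=
    smix₁ _ (annihilation_mixed_sum S c (fun e => orb (v e) 0) (orb x 0) (hoff 0 0))
  have m03 : a0 * star b1 + star b1 * a0 = 0 :=
    smix₁ _ (annihilation_mixed_sum S c (fun e => orb (v e) 1) (orb x 0) (hoff 1 0))
  have m12 : a1 * star b0 + star b0 * a1 = 0 :=
    smix₁ _ (annihilation_mixed_sum S c (fun e => orb (v e) 0) (orb x 1) (hoff 0 1))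
  have m13 : a1 * star b1 + star b1 * a1 = 0 :=
    smix₁ _ (annihilation_mixed_sum S c (fun e => orb (v e) 1) (orb x 1) (hoff 1 1))
  have m23 : b0 * star b1 + star b1 * b0 = 0 := by
    rw [← smul_zero ((r : ℂ) * star (r : ℂ))]
    exact smix _ _ (sum_mixed_sum_eq_zero S c (fun e => orb (v e) 0) S c (fun e => orb (v e) 1) hdisj)
  -- the abstract sum of squares
  have key := two_sub_star_pair_mul_pair_eq_of a0 a1 b0 b1 z0 z1 z2 z3 p01 p02 p03 p12 p13 p23
    d0 d1 d2 d3 m01 m02 m03 m12 m13 m23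
  simp only [Matrix.star_eq_conjTranspose] at key
  have hpsd : (2 - (a0 * b1 - a1 * b0)ᴴ * (a0 * b1 - a1 * b0)).PosSemidef := by
    rw [key, two_mul]
    exact (Matrix.posSemidef_conjTranspose_mul_self _).add
      ((Matrix.posSemidef_conjTranspose_mul_self _).add (Matrix.posSemidef_conjTranspose_mul_self _))
  -- undo the normalisation: `P = √ν • B`
  have hsr : ((Real.sqrt ν : ℝ) : ℂ) * (r : ℂ) = 1 := by
    rw [← Complex.ofReal_mul, hr, mul_inv_cancel₀ hsqrt, Complex.ofReal_one]
  have hψ0' : ψ0 = ((Real.sqrt ν : ℝ) : ℂ) • b0 := by rw [hb0, smul_smul, hsr, one_smul]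
  have hψ1' : ψ1 = ((Real.sqrt ν : ℝ) : ℂ) • b1 := by rw [hb1, smul_smul, hsr, one_smul]
  have hP : a0 * ψ1 - a1 * ψ0 = ((Real.sqrt ν : ℝ) : ℂ) • (a0 * b1 - a1 * b0) := by
    rw [smul_sub, ← Matrix.mul_smul, ← Matrix.mul_smul, ← hψ0', ← hψ1']
  have hPP : (a0 * ψ1 - a1 * ψ0)ᴴ * (a0 * ψ1 - a1 * ψ0) =
      (ν : ℂ) • ((a0 * b1 - a1 * b0)ᴴ * (a0 * b1 - a1 * b0)) := by
    rw [hP, Matrix.conjTranspose_smul, Matrix.smul_mul, Matrix.mul_smul, smul_smul, Complex.star_def,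
      Complex.conj_ofReal, ← Complex.ofReal_mul, Real.mul_self_sqrt hν0]
  have htwo : (2 : Matrix (Finset (Orb Λ)) (Finset (Orb Λ)) ℂ) =
      (2 : ℂ) • (1 : Matrix (Finset (Orb Λ)) (Finset (Orb Λ)) ℂ) := by
    rw [← Algebra.algebraMap_eq_smul_one, map_ofNat]
  have hgoal : (((2 : ℝ) * ν : ℝ) : ℂ) • (1 : Matrix (Finset (Orb Λ)) (Finset (Orb Λ)) ℂ) -
      (a0 * ψ1 - a1 * ψ0)ᴴ * (a0 * ψ1 - a1 * ψ0) =
        (ν : ℂ) • (2 - (a0 * b1 - a1 * b0)ᴴ * (a0 * b1 - a1 * b0)) := by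
    rw [hPP, smul_sub, htwo, smul_smul, Complex.ofReal_mul, Complex.ofReal_ofNat, mul_comm]
  rw [hgoal]
  exact hpsd.smul (Complex.zero_le_real.2 hν0)

end SitePair

/-! ### Local singlet pairs on the torus -/

section Torus

variable (L : ℕ) [NeZero L]

/-- `localPairOn` as a site–bond-mode singlet: `P_x = a_{x↑} ψ_↓ - a_{x↓} ψ_↑` with
`ψ_σ = Σ_{e ∈ S} (g e/√2) a_{(x+e)σ}`. Scalapino, Phys. Rep. 250 (1995) 329, §2 eq. (2.2). [folklore] -/
theorem localPairOn_eq_sitePair (S : Finset (Site 2)) (g : Site 2 → ℝ) (x : TorusSite 2 L) :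
    localPairOn S g L x =
      annihilation (orb (FermionTorus.ofTorusSite x) 0) *
          (∑ e ∈ S, ((g e / Real.sqrt 2 : ℝ) : ℂ) •
            annihilation (orb (FermionTorus.ofTorusSite (x + Torus.proj L e)) 1)) -
        annihilation (orb (FermionTorus.ofTorusSite x) 1) *
          (∑ e ∈ S, ((g e / Real.sqrt 2 : ℝ) : ℂ) •
            annihilation (orb (FermionTorus.ofTorusSite (x + Torus.proj L e)) 0)) := by
  simp only [localPairOn, smul_sub, Finset.sum_sub_distrib, Finset.mul_sum, Matrix.mul_smul]

/-- **Ceiling for `localPairOn`.**  If `0 ∉ S` and the steps `{0} ∪ S` have distinct projections to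
the torus of side `L`, then `(P_x)† P_x ≤ (Σ_{e ∈ S} g(e)²) · 1` for `P_x = localPairOn S g L x`.
Scalapino, Phys. Rep. 250 (1995) 329, §2. [folklore] -/
theorem posSemidef_smul_one_sub_localPairOn (S : Finset (Site 2)) (g : Site 2 → ℝ) (h0 : (0 : Site 2) ∉ S)
    (hS : Set.InjOn (Torus.proj L) ((insert (0 : Site 2) S : Finset (Site 2)) : Set (Site 2)))
    (x : TorusSite 2 L) :
    (((∑ e ∈ S, g e ^ 2 : ℝ) : ℂ) •
        (1 : Matrix (Finset (Orb (FermionTorus 2 L))) (Finset (Orb (FermionTorus 2 L))) ℂ) -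
      (localPairOn S g L x)ᴴ * localPairOn S g L x).PosSemidef := by
  have hv : Set.InjOn (fun e : Site 2 => FermionTorus.ofTorusSite (x + Torus.proj L e)) S := by
    intro e he e' he' h
    have h' := congrArg FermionTorus.toTorusSite h
    simp only [FermionTorus.toTorusSite_ofTorusSite, add_right_inj] at h'
    exact hS (Finset.mem_coe.2 (Finset.mem_insert_of_mem he))
      (Finset.mem_coe.2 (Finset.mem_insert_of_mem he')) h'
  have hx : ∀ e ∈ S, FermionTorus.ofTorusSite (x + Torus.proj L e) ≠ FermionTorus.ofTorusSite x := by
    intro e he h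
    have h' := congrArg FermionTorus.toTorusSite h
    simp only [FermionTorus.toTorusSite_ofTorusSite, add_eq_left] at h'
    have h0' : Torus.proj L e = Torus.proj L 0 := by
      rw [h']; funext i; simp [Torus.proj_apply]
    exact h0 ((hS (Finset.mem_coe.2 (Finset.mem_insert_of_mem he))
      (Finset.mem_coe.2 (Finset.mem_insert_self 0 S)) h0') ▸ he)
  have hsum : (2 : ℝ) * ∑ e ∈ S, ‖((g e / Real.sqrt 2 : ℝ) : ℂ)‖ ^ 2 = ∑ e ∈ S, g e ^ 2 := by
    rw [Finset.mul_sum]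
    refine Finset.sum_congr rfl fun e _ => ?_
    rw [Complex.norm_real, Real.norm_eq_abs, sq_abs, div_pow, Real.sq_sqrt zero_le_two]
    ring
  have h := posSemidef_smul_one_sub_sitePair S (fun e => ((g e / Real.sqrt 2 : ℝ) : ℂ))
    (fun e => FermionTorus.ofTorusSite (x + Torus.proj L e)) (FermionTorus.ofTorusSite x) hv hx
  rw [hsum] at h
  rw [localPairOn_eq_sitePair]
  -- `convert` reconciles the `DecidableEq` instances hidden in `(1 : Matrix _ _ ℂ)`
  convert h

/-- `Σ_{e ∈ unitSteps} g_d(e)² = 4`. Scalapino, Phys. Rep. 250 (1995) 329, §2 eq. (2.3). [folklore] -/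
theorem sum_unitSteps_sq_dWaveFormFactor : ∑ e ∈ unitSteps, dWaveFormFactor e ^ 2 = 4 := by
  rw [Finset.sum_congr rfl fun e he => PairFieldYang.sq_dWaveFormFactor_of_mem_unitSteps he,
    Finset.sum_const, PairFieldYang.card_unitSteps_eq_four]
  norm_num

/-- **The sharp kinematic ceiling of the `d_{x²-y²}` local pair: `P_x† P_x ≤ 4`** on every torus of
side `L ≥ 3` (an operator inequality on Fock space; every state, every Hamiltonian).
Scalapino, Phys. Rep. 250 (1995) 329, §2 eq. (2.2)–(2.4). [folklore] -/
theorem posSemidef_four_smul_one_sub_localPair_dWave (hL : 3 ≤ L) (x : TorusSite 2 L) :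
    ((4 : ℂ) • (1 : Matrix (Finset (Orb (FermionTorus 2 L))) (Finset (Orb (FermionTorus 2 L))) ℂ) -
      (localPair dWaveFormFactor L x)ᴴ * localPair dWaveFormFactor L x).PosSemidef := by
  have h := posSemidef_smul_one_sub_localPairOn L unitSteps dWaveFormFactor
    (by decide) (PairFieldYang.torusProj_injOn_insert_zero_unitSteps hL) x
  rw [sum_unitSteps_sq_dWaveFormFactor, ← localPair_dWave_eq_localPairOn_unitSteps] at h
  convert h using 3
  norm_num

/-- `Re ⟨ψ, P_x† P_x ψ⟩ ≤ 4 Re ⟨ψ, ψ⟩` for the `d_{x²-y²}` local pair (`L ≥ 3`).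
Scalapino, Phys. Rep. 250 (1995) 329, §2. [folklore] -/
theorem re_expect_localPair_dWave_sq_le (hL : 3 ≤ L) (x : TorusSite 2 L)
    (ψ : Fock (Orb (FermionTorus 2 L))) :
    (expect ((localPair dWaveFormFactor L x)ᴴ * localPair dWaveFormFactor L x) ψ).re ≤
      4 * (star ψ ⬝ᵥ ψ).re := by
  have h := (posSemidef_four_smul_one_sub_localPair_dWave L hL x).dotProduct_mulVec_nonneg ψ
  rw [Matrix.sub_mulVec, dotProduct_sub, Matrix.smul_mulVec, Matrix.one_mulVec,
    dotProduct_smul, sub_nonneg, Complex.le_def] at h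
  have h1 := h.1
  rw [smul_eq_mul, Complex.mul_re] at h1
  simpa [expect] using h1

/-- **`‖P_x ψ‖ ≤ 2 ‖ψ‖`** for the `d_{x²-y²}` local pair (`L ≥ 3`; compare `norm_toLp_localPair_mulVec_le`,
constant `Σ_e 2|g_d e|/√2 = 4√2`). Scalapino, Phys. Rep. 250 (1995) 329, §2. [folklore] -/
theorem norm_toLp_localPair_dWave_mulVec_le (hL : 3 ≤ L) (x : TorusSite 2 L)
    (ψ : Fock (Orb (FermionTorus 2 L))) :
    ‖(WithLp.toLp 2 (localPair dWaveFormFactor L x *ᵥ ψ) :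
        EuclideanSpace ℂ (Finset (Orb (FermionTorus 2 L))))‖ ≤
      2 * ‖(WithLp.toLp 2 ψ : EuclideanSpace ℂ (Finset (Orb (FermionTorus 2 L))))‖ := by
  refine le_of_pow_le_pow_left₀ two_ne_zero (by positivity) ?_
  rw [mul_pow, norm_toLp_sq_eq_re, norm_toLp_sq_eq_re, ← PosSemidefTrace.expect_conjTranspose_mul]
  calc _ ≤ 4 * (star ψ ⬝ᵥ ψ).re := re_expect_localPair_dWave_sq_le L hL x ψ
    _ = (2 : ℝ) ^ 2 * (star ψ ⬝ᵥ ψ).re := by norm_num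

/-- **Every term of the `d`-wave pair two-point function is at most `4` in modulus**: for a
normalised state `ψ` and `L ≥ 3`, `|Re ⟨ψ, P_x† P_y ψ⟩| ≤ 4` (Cauchy–Schwarz with
`‖P_x ψ‖, ‖P_y ψ‖ ≤ 2`; the tree's `abs_re_expect_localPair_le` gives `32`).
Scalapino, Phys. Rep. 250 (1995) 329, §2 eq. (2.4). [folklore] -/
theorem abs_re_expect_localPair_dWave_le_four (hL : 3 ≤ L) (ψ : Fock (Orb (FermionTorus 2 L)))
    (hψ : star ψ ⬝ᵥ ψ = 1) (x y : TorusSite 2 L) :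
    |(expect ((localPair dWaveFormFactor L x)ᴴ * localPair dWaveFormFactor L y) ψ).re| ≤ 4 := by
  rw [PosSemidefTrace.expect_conjTranspose_mul, star_dotProduct_eq_inner]
  have h1 : ‖(WithLp.toLp 2 ψ : EuclideanSpace ℂ (Finset (Orb (FermionTorus 2 L))))‖ = 1 := by
    have h := norm_toLp_sq_eq_re ψ
    rw [hψ, Complex.one_re] at h
    exact (pow_eq_one_iff_of_nonneg (norm_nonneg _) two_ne_zero).1 h
  refine (Complex.abs_re_le_norm _).trans ((norm_inner_le_norm _ _).trans ?_)
  have hx := norm_toLp_localPair_dWave_mulVec_le L hL x ψ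
  have hy := norm_toLp_localPair_dWave_mulVec_le L hL y ψ
  rw [h1, mul_one] at hx hy
  calc _ ≤ 2 * 2 := mul_le_mul hx hy (norm_nonneg _) zero_le_two
    _ = 4 := by norm_num

end Torus

end SingletPair

end Summit.Ventures.CertifiedManyBodySolver.Observables
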